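import Summits.HodgeConjecture.HodgeConjecture.Theorems.R90S9GermCofinalityOfLevels     -- ★ (R90-IF-p04 (g2), deal (e)): `exists_level_gradePacket_eq_of_evpRep` — a packet carrying the germ of a discrete class is graded at every deep level
import HarnessLib

/-!
# R90-TF · S9 «InnerForm-13.3.6 (c)» — THE COFINALITY PIN `hcover` OF ★ `hmn_gammaSph_ofLevelPins` (MN-cm), PAID S9-INTERNALLY at `Γ₀^{sph} = gammaSph X`:
# «`S′` is chosen large enough so that `π_v` is unramified for `v ∉ S′`» (Rogawski 1990 §14.6 p. 242 l. 15–16) for a test pair AND a packet with a discrete e.v.p.-partner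

Cell `hodgecm-mathlib`, crux H413 (`stmt-HodgeConjecture-24833`, lane `--supports … --as helper`), route of record `HCCMUnconditional` (no route verbs; count-neutral).
Programme R90-TF (brief `director/R90-BRIEF.v2.md` 1f40d54518340a35), section S9 = InnerForm-13.3.6 (c) (base `R90-IF`); seat R90-IF-p07 (g0), DEFAULT OFFER (O-cover) (R90 bus
2026-09-04T23:32Z; R90-IF-audit1 BOX 23:15:45Z named it «S9-INTERNAL candidate: (e)-style cofinality for `P` with partner `π′` + the level of `f′`»).  THEOREMS ONLY: no `def`, no
instance, no notation, no named fact, no `sorry`; imports ★ `Theorems` only; namespace `Summit.HodgeConjecture.HodgeConjecture.R90.S9.InnerFormSec146`.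
HONEST LABEL: HC_CM is proved only modulo the 7 printed citations (2 remaining named inputs: hLiu418 = stmt-HodgeConjecture-24832, h413 = stmt-HodgeConjecture-24833) — until
rung 0 closes.  This file proves no printed statement: it discharges ONE binder of the (MN-cm) payer ★ p862961 — the cofinality of R90-IF-p04 (g2)'s level datum for the pairs
`(f′, Π)` the (MN) organ meets — from ★ facts already in the tree; its own hypotheses are `H` anisotropic (`hanis`) and the cofinite existence of level-matching frames
(`hframe`, the binder of ★ `hgermLevel_gammaSph` verbatim: ★ `eventually_exists_cmDatumLocalCongr_levelMatching_three` at the quasi-split form; in general S1 ∕ S4).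

## The mathematics
`hcover` of ★ `hmn_gammaSph_ofLevelPins` reads: for a test pair `f′` of the linear-independence class `𝓣`, a discrete packet `Π` HAVING A DISCRETE E.V.P.-PARTNER `π₀` (`m(π₀) ≠ 0`,
`t(π₀) = t(Π)`), and any finite `l₀`, there is a level `l ⊇ l₀` at which `f′` is a level test (`IsLevelTest l f′`) and `Π` is graded (`gradePacket l Π = some e`).  Take
`l ⊇ l₀ ∪ T(f′)`, `T(f′) = {v | f′_v ≠ 𝟙_{K_v}}` (finite for a restricted pure tensor), deep enough that `Π` is graded — ★ `exists_level_gradePacket_eq_of_evpRep` (the germ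
`t(π₀) = t(Π)` makes the component `π₀,v` THE transporting class at almost every `v`: admissible, unitarizable, `K_v`-spherical by Flath on the compact quotient, unique along a
level-matching frame).  Off `l` the factor `f′_v = 𝟙_{K_v}` is bi-`K_v`-invariant (★ `IsLevel.indicator`), so `f′` is a level test at `l`.  The class `𝓣` enters only
through its three «restricted pure tensor» clauses (`h𝓣`; for typ2's pin `𝓣 := Smooth_cm …` of ★ `R90S9DatumOfRecordCM`: `h𝓣 := fun p hp => hp.1`).

## What is here (sorry-free, axioms ⊆ {propext, Classical.choice, Quot.sound})
* **`hcover_gammaSph_of_partner`** — conclusion = the `hcover` binder of ★ `hmn_gammaSph_ofLevelPins` (p862961) TYPE token for token, for any class `𝓣` inside the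
  restricted pure tensors (`h𝓣`), from `hanis` + `hframe`.
[cite: Rogawski1990, §14.6 p. 242 l. 10–16 (chunk p0236 L6–9); §14.2 p. 233; §13.7 p. 206] [cite: FlathCorvallis1979, Thm. 3] [cite: GetzHahn2024, §5.3 p. 101]
-/

set_option autoImplicit false
set_option linter.dupNamespace false  -- the mandated namespace repeats the summit's segment (`HodgeConjecture.HodgeConjecture`)

noncomputable section

open NumberField IsDedekindDomain MeasureTheory Filter
open scoped Matrix MatrixGroups Classical
open Literature.NumberTheory Literature.NumberTheory.Automorphic Literature.NumberTheory.Automorphic.UnitaryGroup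
open Literature.NumberTheory.Rogawski1990
open Summit.HodgeConjecture.HodgeConjecture.Cruxes.H413 Summit.HodgeConjecture.HodgeConjecture.Cruxes.H413.F0P3ClassTokenChoice
open Summit.HodgeConjecture.HodgeConjecture.Cruxes.H413.F0P3GlobalPacket Summit.HodgeConjecture.HodgeConjecture.Cruxes.H413.F0P3LocalPacketKit

namespace Summit.HodgeConjecture.HodgeConjecture.R90.S9.InnerFormSec146

section Cover

variable (TG' TG TH : Type) (L : Type) [Field L] [NumberField L] [IsCMField L] (ι : L →+* ℂ) (H : Matrix (Fin 3) (Fin 3) L) (T : GL (Fin 3) ℂ)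
  (hT : (T : Matrix (Fin 3) (Fin 3) ℂ)ᴴ * H.map ι * (T : Matrix (Fin 3) (Fin 3) ℂ) = Literature.Geometry.ComplexHyperbolic.BallModel.J)
  (μA : Measure (adelicGroupData (↥(maximalRealSubfield L)) L (IsCMField.complexConj L) 3 H).automorphicQuotient)
  [(adelicGroupData (↥(maximalRealSubfield L)) L (IsCMField.complexConj L) 3 H).IsAutomorphicMeasure μA]
  (μv : ∀ v : HeightOneSpectrum (𝓞 ↥(maximalRealSubfield L)), @Measure ((cmDatum L 3 H).Local v) (borel _))
  (Ξ : OneDimAutRepH L → PacketPrimeFin L H) {H' : Matrix (Fin 3) (Fin 3) L}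
  (𝔩 : ∀ v : HeightOneSpectrum (𝓞 ↥(maximalRealSubfield L)), LocalPacketKit L H' v)
  (X : DatumInputs ((UnitaryGroup.arch (↥(maximalRealSubfield L)) L (IsCMField.complexConj L) 3 H → ℂ) ×
      (∀ v : HeightOneSpectrum (𝓞 ↥(maximalRealSubfield L)), (cmDatum L 3 H).Local v → ℂ)) TG TH L ι H T hT μA Ξ 𝔩)

/-- **THE COFINALITY PIN `hcover` OF ★ `hmn_gammaSph_ofLevelPins`, PAID** («`S′` is chosen large enough so that `π_v` is unramified for `v ∉ S′`», p. 242 l. 15–16): for `H`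
anisotropic (`hanis`) and cofinitely many level-matching frames for the kit's form (`hframe`, the binder of ★ `hgermLevel_gammaSph` VERBATIM), every test pair `f′` of a class
`𝓣` lying inside the restricted pure tensors (`h𝓣`: archimedean factor in ★ `ArchTestKc`, finite factors locally constant and compactly supported, almost all equal to `𝟙_{K_v}`)
and every discrete packet `P` WITH A DISCRETE E.V.P.-PARTNER have, above any finite `l₀`, a common level `l ⊇ l₀` with `IsLevelTest l f′` and `gradePacket l P = some e` —
the `hcover` binder of ★ p862961 TYPE token for token.  Proof: ★ `exists_level_gradePacket_eq_of_evpRep` above `l₀ ∪ T(f′)`; off that level `f′_v = 𝟙_{K_v}` is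
bi-`K_v`-invariant (★ `IsLevel.indicator`, ★ `isCompact_isOpen_cmLocalIntegralLevel`). [cite: Rogawski1990, §14.6 p. 242 l. 10–16 (chunk p0236 L6–9); §14.2 p. 233] [cite: FlathCorvallis1979, Thm. 3] -/
theorem hcover_gammaSph_of_partner
    (hanis : ∀ y : Fin 3 → L, Literature.AlgebraicGeometry.ShimuraVarieties.hermForm (cmConjRingHom L) H y y = 0 → y = 0)
    (hframe : ∀ᶠ v : HeightOneSpectrum (𝓞 ↥(maximalRealSubfield L)) in cofinite,
      ∃ (T₁ : GL (Fin 3) (LocalRing L v)) (a : LocalRing L v) (ha : IsUnit a)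
        (h : formCongr (conjLocal L (IsCMField.complexConj L) v) T₁ (H.map (algebraMap L (LocalRing L v))) = a • H'.map (algebraMap L (LocalRing L v))),
        ∀ g : (cmDatum L 3 H).Local v, (cmDatumLocalCongr L v T₁ ha h).symm g ∈ cmLocalIntegralLevel L 3 H' v ↔ g ∈ cmLocalIntegralLevel L 3 H v)
    (𝓣 : (UnitaryGroup.arch (↥(maximalRealSubfield L)) L (IsCMField.complexConj L) 3 H → ℂ) ×
        (∀ v : HeightOneSpectrum (𝓞 ↥(maximalRealSubfield L)), (cmDatum L 3 H).Local v → ℂ) → Prop)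
    (h𝓣 : ∀ p : (UnitaryGroup.arch (↥(maximalRealSubfield L)) L (IsCMField.complexConj L) 3 H → ℂ) ×
        (∀ v : HeightOneSpectrum (𝓞 ↥(maximalRealSubfield L)), (cmDatum L 3 H).Local v → ℂ), 𝓣 p →
      ArchTestKc L ι H T hT p.1 ∧ (∀ v, IsLocallyConstant (p.2 v) ∧ HasCompactSupport (p.2 v)) ∧
        {v | p.2 v ≠ (cmLocalIntegralLevel L 3 H v : Set ((cmDatum L 3 H).Local v)).indicator fun _ => (1 : ℂ)}.Finite) :
    ∀ f' : (UnitaryGroup.arch (↥(maximalRealSubfield L)) L (IsCMField.complexConj L) 3 H → ℂ) ×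
        (∀ v : HeightOneSpectrum (𝓞 ↥(maximalRealSubfield L)), (cmDatum L 3 H).Local v → ℂ), 𝓣 f' → ∀ P : X.G.Packet,
      (∃ π' : RepPrimeSph L ι H T hT μA, mPrimeSph L ι H T hT μA π' ≠ 0 ∧ (gammaSph _ TG TH L ι H T hT μA Ξ 𝔩 X).evpRep π' P) →
      ∀ l₀ : Level L, ∃ l : Level L, l₀ ⊆ l ∧ ∃ e : Evp L H,
        IsLevelTest L ι H T hT l f' ∧ gradePacket _ TG TH L ι H T hT μA μv Ξ 𝔩 X l P = some e := by
  intro f' hF P hP l₀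
  obtain ⟨π₀, -, hevp⟩ := hP
  obtain ⟨harch, hloc, hfin⟩ := h𝓣 f' hF
  -- a level above `l₀` and the exceptional places of `f′` at which `P` is graded (germ cofinality for the partner's germ)
  obtain ⟨l, hl, e, hPl, -⟩ := exists_level_gradePacket_eq_of_evpRep _ TG TH L ι H T hT μA μv Ξ 𝔩 X hanis hframe π₀ P P hevp hevp
    (l₀ ∪ hfin.toFinset)
  refine ⟨l, Finset.subset_union_left.trans hl, e, ⟨harch, hloc, fun v hv => ?_, hfin⟩, hPl⟩
  -- off `l ⊇ T(f′)` the factor is the unit `𝟙_{K_v}`, which is bi-`K_v`-invariant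
  have hv' : f'.2 v = (cmLocalIntegralLevel L 3 H v : Set ((cmDatum L 3 H).Local v)).indicator fun _ => (1 : ℂ) := by
    by_contra hne
    exact hv (hl (Finset.mem_union_right _ (hfin.mem_toFinset.2 hne)))
  rw [hv']
  have hK := isCompact_isOpen_cmLocalIntegralLevel L 3 H v
  exact IsLevel.indicator hK.2 hK.1

end Cover

end Summit.HodgeConjecture.HodgeConjecture.R90.S9.InnerFormSec146

end
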